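import Literature.AlgebraicGeometry.HodgeTheory.ComplexTorusIntegralHodgeClassesPontryaginCorrespondencesComposition
import Literature.AlgebraicGeometry.HodgeTheory.ComplexTorusIntegralHodgeClassesKunnethGradingActions
import Literature.AlgebraicGeometry.HodgeTheory.ComplexTorusIntegralHodgeClassesCorrespondencePushforwards
import Literature.AlgebraicGeometry.HodgeTheory.ComplexTorusIntegralHodgeClassesCorrespondenceCrossComposition
import Literature.AlgebraicGeometry.HodgeTheory.ComplexTorusIntegralHodgeClassesCorrespondenceAdjunction
import HarnessLib

/-!
# Pontryagin correspondences III: `Π_c = δ^*c` for the difference map `δ = pr₂ − pr₁`, naturality `(f × f)^*Π_c = Π_{f^*c}`, and the degenerate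
# correspondences `x ⊠ y` as simultaneous eigen-correspondences of `Π_c`, `Δ_*(u)` and `H`

Third file on the Pontryagin correspondences `Π_c = (s_X)_*(p₂^*c) ∈ Hdgᵈ(X × X, ℤ)` of g33-#7 / g34-#1 (`ComplexTorusIntegralHodgeClassesPontryaginCorrespondences`,
`…PontryaginCorrespondencesComposition`), on the integral carriers `Hdg•(−, ℤ)` of complex tori.

* §1 **`Π_c = δ^*c` with `δ = pr₂ − pr₁ : X × X → X`** (and `= (pr₁ − pr₂)^*c`): the push-forward of `p₂^*c` along the shear isomorphism `s = (pr₁, pr₁ + pr₂)` is the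
  pull-back along `p₂ ∘ s⁻¹ = pr₂ − pr₁` (`φ_* = (φ⁻¹)^*`, g27-#3). This is the presentation of the correspondence of the operator `Λ` used by Milne and at Layer A
  ("`Λ_{c₁(L)} = (δ^* c_L)^*`, `δ = pr₁ − pr₂`", `Geometry/Kaehler/ComplexTorusLefschetzDualCorrespondence`; Milne: "the operator `Λ` is defined by a Lefschetz class")
  [cite: Milne1999LefschetzClasses, §5 Thm. 5.9 with proof (p0026 L74 – p0027 L9)] [cite: Lange2023AbelianVarietiesComplex, §6.3.2 (p0316 L9–L15: `c_L := L^{·(g−1)}/(d(g−1)!)`) and §6.3.4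
  (p0319 L28–L36)], and Polishchuk's change of variables on `A × A` [cite: Polishchuk2007FourierStable, §1 proof of Lemma 1.4 (arXiv p0003 L126)]; with g33-#7 §2 it
  says `(δ^*c)_*(x) = x ⋆ c`.
* §2 **NATURALITY `(f × f)^*Π_c = Π_{f^*c}`** for every homomorphism `f : X′ → X` (`δ_X ∘ (f × f) = f ∘ δ_{X′}`: `f` is additive), in particular `(n_X × n_X)^*Π_c =
  n^{2d} • Π_c` [cite: Lange2023AbelianVarietiesComplex, §6.2.2 Prop. 6.2.10 (a) (p0304 L30–L42: "`(f₁ × f₂)^*Z = ᵗΓ_{f₂} ∘ Z ∘ Γ_{f₁}`") and §6.3.1 (p0313 L5–L15)].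
* §3 **THE DEGENERATE CORRESPONDENCES `x ⊠ y` ARE SIMULTANEOUS EIGEN-CORRESPONDENCES**: by Fulton's Example 16.1.2 (a)/(b) `β ∘ (x ⊠ y) = x ⊠ β_*(y)`, `(x ⊠ y) ∘ α =
  α^*(x) ⊠ y` (g29 `…CorrComp_integralHodgeClassesCross_left/_right`) [cite: Fulton1998, §16.1 Example 16.1.2 (a), (b) (p0296 L1–L8)] and the computed actions
  `(Π_c)_* = (Π_c)^* = (−) ⋆ c` (g33-#7 §2, g34-#1 §2), `(Δ_*(u))_* = (Δ_*(u))^* = u · (−)` (g33-#3 §2) and `H_* = (2p − g)`, `H^* = (g − 2p)` on `Hdgᵖ` (g33-#6 §1):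
  **`Π_c ∘ (x ⊠ y) = x ⊠ (y ⋆ c)`**, **`(x ⊠ y) ∘ Π_c = (x ⋆ c) ⊠ y`**, **`Δ_*(u) ∘ (x ⊠ y) = x ⊠ (u · y)`**, **`(x ⊠ y) ∘ Δ_*(u) = (u · x) ⊠ y`**,
  **`H ∘ (x ⊠ y) = (2q − g) • (x ⊠ y)`**, **`(x ⊠ y) ∘ H = (g − 2p) • (x ⊠ y)`** — the rank-one correspondences `x ⊠ y ∈ Hdgᵖ(W) ⊠ Hdg^q(X)` diagonalise the
  three generators of the Lefschetz–Pontryagin calculus [cite: Lange2023AbelianVarietiesComplex, §6.2.3 (p0308 L3–L7) and §6.2.4 (6.10) (p0310 L33–L35)]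
  [cite: Huybrechts2005, §1.2 Def. 1.2.25 (p0047 L7–L9)] (§3 left compositions, §4 right compositions);
* §5 **`(x′ ⊠ y′) ∘ (x ⊠ y) = deg_X(x′ · y) • (x ⊠ y′)`**: rank-one correspondences compose like matrix units, through the intersection number of the inner classes
  (Fulton's "if `α = [V × W]`, then `β ∘ α = [V] × p_{Z*}([W × Z] · β)`" and the degenerate action `(x′ ⊠ y′)_*(y) = deg_X(x′ · y) · y′`, g27-#6)
  [cite: Fulton1998, §16.1 Example 16.1.2 (a) (p0296 L7–L9)];
* §6 **`deg((x ⋆ c) · y) = deg(x · (y ⋆ c))`**: the Pontryagin product with `c` is self-adjoint for the intersection pairing — Fulton's adjunction `∫_X a · α^*(b) = ∫_Y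
  α_*(a) · b` [cite: Fulton1998, §16.1 Example 16.1.14 (i) (p0302 L7–L12)] (g28 `…Deg_corrAct_cup_eq_deg_cup_corrCoact`) for the symmetric correspondence `Π_c`.

All statements are theorems; no definition, no named fact (D-0026); frames and degree bookkeeping explicit and arbitrary as in g27–g34.

## References

* [Lange2023AbelianVarietiesComplex] H. Lange, Abelian Varieties over the Complex Numbers, Springer 2023 — §6.2.2 Prop. 6.2.10, §6.2.3, §6.2.4 (6.10), §6.3.1, §6.3.2, §6.3.4.
* [Fulton1998] W. Fulton, Intersection Theory, 2nd ed., Springer 1998 — §16.1 Example 16.1.2, Example 1.7.4.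
* [Milne1999LefschetzClasses] J. S. Milne, Lefschetz classes on abelian varieties, Duke Math. J. 96 (1999) — §5 Thm. 5.9.
* [Polishchuk2007FourierStable] A. Polishchuk, Fourier-stable subrings in the Chow rings of abelian varieties, arXiv:0705.0772 — §1.
* [Huybrechts2005] D. Huybrechts, Complex Geometry, Springer 2005 — §1.2 Def. 1.2.25.
-/

noncomputable section

open CategoryTheory Function

namespace Literature.AlgebraicGeometry.HodgeTheory

open Literature.AlgebraicGeometry.Motives Literature.AlgebraicGeometry.Motives.HodgeStructure
open Literature.Geometry.Kaehler Literature.Geometry.Kaehler.ComplexTorus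

namespace ComplexTorusCat

/-! ## §0 Plumbing: `pr₁ − pr₂ = (pr₂ − pr₁) ≫ (−1)_X`, `(f × f) ≫ δ_X = δ_{X′} ≫ f` -/

section Plumbing

variable (X : ComplexTorusCat) {X' : ComplexTorusCat} (f : X' ⟶ X)

/-- `pr₁ − pr₂ = (pr₂ − pr₁) ≫ (−1)_X`. [cite: Lange2023AbelianVarietiesComplex, §1.1.2 (p0019 L18–L26)] -/
theorem fstHom_sub_sndHom_eq_comp_intMul_neg_one : fstHom X X - sndHom X X = (sndHom X X - fstHom X X) ≫ intMul X (-1) := by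
  rw [comp_intMul, neg_smul, one_smul, neg_sub]

/-- **`(f × f) ≫ δ_X = δ_{X′} ≫ f`** for the difference maps `δ = pr₂ − pr₁`: a homomorphism commutes with subtraction.
[cite: Lange2023AbelianVarietiesComplex, §1.1.2 (p0019 L18–L26)] -/
theorem prodMap_comp_sndHom_sub_fstHom : prodMap f f ≫ (sndHom X X - fstHom X X) = (sndHom X' X' - fstHom X' X') ≫ f := by
  rw [Preadditive.comp_sub, prodMap_sndHom, prodMap_fstHom, Preadditive.sub_comp]

end Plumbing

/-! ## §1 `Π_c = δ^*c` -/

section DifferenceMap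

variable (X : ComplexTorusCat) {gXX : ℕ} (eXX : Fin (2 * gXX) ≃ (prodObj X X).toIsog.ι) (hgXX : gXX + gXX = 2 * gXX) {d L : ℕ} (hq : L + 2 * d = 2 * gXX)

/-- **`Π_c = δ^*c` FOR THE DIFFERENCE MAP `δ = pr₂ − pr₁ : X × X → X`**: the Pontryagin correspondence `(s_X)_*(p₂^*c)` of `c ∈ Hdgᵈ(X, ℤ)` is the pull-back of `c`
along `(x, y) ↦ y − x` — the shear `s = (pr₁, pr₁ + pr₂)` is an isomorphism with inverse `(pr₁, pr₂ − pr₁)`, `s_* = (s⁻¹)^*` (g27-#3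
`integralHodgeClassesPushforward_of_isIso`) and `p₂ ∘ s⁻¹ = pr₂ − pr₁`. The presentation "`Λ = (δ^*c_L)^*`" of the Lefschetz-dual operator by a Lefschetz class
(Milne's Thm. 5.9, Layer A `ComplexTorusLefschetzDualCorrespondence`), here for every `c` on the integral carriers; with g33-#7 §2, `(δ^*c)_*(x) = x ⋆ c`.
[cite: Milne1999LefschetzClasses, §5 Thm. 5.9 with proof (p0026 L74 – p0027 L9)] [cite: Lange2023AbelianVarietiesComplex, §6.3.2 (p0316 L9–L15) and §6.3.4 (p0319 L28–L36)]
[cite: Polishchuk2007FourierStable, §1 proof of Lemma 1.4 (arXiv p0003 L126)] [cite: Fulton1998, Example 1.7.4 (p0031 L17–L21)] -/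
theorem pontryaginCorrespondence_eq_pullbackHom_sndHom_sub_fstHom (c : integralHodgeClasses X.toIsog.Φ d) :
    integralHodgeClassesPushforward d d (liftHom (fstHom X X) (fstHom X X + sndHom X X)) eXX eXX hq hgXX hq hgXX
        (integralHodgeClassesPullbackHom (sndHom X X) d c) =
      integralHodgeClassesPullbackHom (sndHom X X - fstHom X X) d c := by
  haveI : IsIso (liftHom (fstHom X X) (fstHom X X + sndHom X X)) :=
    ⟨⟨liftHom (fstHom X X) (sndHom X X - fstHom X X), liftHom_fst_add_comp_liftHom_fst_sub X, liftHom_fst_sub_comp_liftHom_fst_add X⟩⟩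
  rw [integralHodgeClassesPushforward_of_isIso (liftHom (fstHom X X) (fstHom X X + sndHom X X)) eXX eXX hq hgXX,
    IsIso.inv_eq_of_hom_inv_id (liftHom_fst_add_comp_liftHom_fst_sub X), ← integralHodgeClassesPullbackHom_comp, liftHom_sndHom]

/-- **`Π_c = (pr₁ − pr₂)^*c`** as well: `(pr₁ − pr₂)^* = (pr₂ − pr₁)^* ∘ (−1)_X^*` and `(−1)_X^* = (−1)^{2d} = 1` on `Hdgᵈ(X, ℤ)` (g24
`integralHodgeClassesPullbackHom_intMul`) — Milne's and Layer A's orientation `δ = pr₁ − pr₂` of the difference map.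
[cite: Milne1999LefschetzClasses, §5 Thm. 5.9 with proof (p0026 L74 – p0027 L9)] [cite: Lange2023AbelianVarietiesComplex, §6.3.1 (p0313 L5–L15)] -/
theorem pontryaginCorrespondence_eq_pullbackHom_fstHom_sub_sndHom (c : integralHodgeClasses X.toIsog.Φ d) :
    integralHodgeClassesPushforward d d (liftHom (fstHom X X) (fstHom X X + sndHom X X)) eXX eXX hq hgXX hq hgXX
        (integralHodgeClassesPullbackHom (sndHom X X) d c) =
      integralHodgeClassesPullbackHom (fstHom X X - sndHom X X) d c := by
  rw [pontryaginCorrespondence_eq_pullbackHom_sndHom_sub_fstHom, fstHom_sub_sndHom_eq_comp_intMul_neg_one, integralHodgeClassesPullbackHom_comp,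
    integralHodgeClassesPullbackHom_intMul, pow_mul, neg_one_sq, one_pow, one_zsmul]

/-! ## §2 Naturality `(f × f)^*Π_c = Π_{f^*c}` -/

variable {X' : ComplexTorusCat} (f : X' ⟶ X) {gXX' : ℕ} (eXX' : Fin (2 * gXX') ≃ (prodObj X' X').toIsog.ι) (hgXX' : gXX' + gXX' = 2 * gXX') {L' : ℕ}
  (hq' : L' + 2 * d = 2 * gXX')

/-- **NATURALITY `(f × f)^*Π_c = Π_{f^*c}`** for every homomorphism `f : X′ → X` of complex tori and every `c ∈ Hdgᵈ(X, ℤ)`: `(f × f)^*δ_X^*c = δ_{X′}^*(f^*c)` since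
`δ_X ∘ (f × f) = f ∘ δ_{X′}` (§0, §1). Compare Lange's `(f₁ × f₂)^*Z = ᵗΓ_{f₂} ∘ Z ∘ Γ_{f₁}`. [cite: Lange2023AbelianVarietiesComplex, §6.2.2 Prop. 6.2.10 (a) (p0304 L30–L42)] -/
theorem integralHodgeClassesPullbackHom_prodMap_pontryaginCorrespondence (c : integralHodgeClasses X.toIsog.Φ d) :
    integralHodgeClassesPullbackHom (prodMap f f) d
        (integralHodgeClassesPushforward d d (liftHom (fstHom X X) (fstHom X X + sndHom X X)) eXX eXX hq hgXX hq hgXX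
          (integralHodgeClassesPullbackHom (sndHom X X) d c)) =
      integralHodgeClassesPushforward d d (liftHom (fstHom X' X') (fstHom X' X' + sndHom X' X')) eXX' eXX' hq' hgXX' hq' hgXX'
        (integralHodgeClassesPullbackHom (sndHom X' X') d (integralHodgeClassesPullbackHom f d c)) := by
  rw [pontryaginCorrespondence_eq_pullbackHom_sndHom_sub_fstHom X eXX hgXX hq c,
    pontryaginCorrespondence_eq_pullbackHom_sndHom_sub_fstHom X' eXX' hgXX' hq' (integralHodgeClassesPullbackHom f d c),
    ← integralHodgeClassesPullbackHom_comp (prodMap f f) d (sndHom X X - fstHom X X) c, prodMap_comp_sndHom_sub_fstHom X f,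
    integralHodgeClassesPullbackHom_comp (sndHom X' X' - fstHom X' X') d f c]

/-- **`(n_X × n_X)^*Π_c = n^{2d} • Π_c`**: the Pontryagin correspondence of a class of codimension `d` is homogeneous of weight `2d` under the simultaneous
multiplications (§2 with `f = n_X` and `n_X^* = n^{2d}` on `Hdgᵈ`, g24). [cite: Lange2023AbelianVarietiesComplex, §6.3.1 (p0313 L5–L15) and §6.2.2 Prop. 6.2.10 (a) (p0304 L30–L42)] -/
theorem integralHodgeClassesPullbackHom_prodMap_intMul_intMul_pontryaginCorrespondence (n : ℤ) (c : integralHodgeClasses X.toIsog.Φ d) :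
    integralHodgeClassesPullbackHom (prodMap (intMul X n) (intMul X n)) d
        (integralHodgeClassesPushforward d d (liftHom (fstHom X X) (fstHom X X + sndHom X X)) eXX eXX hq hgXX hq hgXX
          (integralHodgeClassesPullbackHom (sndHom X X) d c)) =
      (n ^ (2 * d)) • integralHodgeClassesPushforward d d (liftHom (fstHom X X) (fstHom X X + sndHom X X)) eXX eXX hq hgXX hq hgXX
        (integralHodgeClassesPullbackHom (sndHom X X) d c) := by
  rw [integralHodgeClassesPullbackHom_prodMap_pontryaginCorrespondence X eXX hgXX hq (intMul X n) eXX hgXX hq, integralHodgeClassesPullbackHom_intMul, map_zsmul,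
    map_zsmul]

end DifferenceMap

/-! ## §3 Degenerate correspondences `x ⊠ y` as eigen-correspondences: compositions on the left -/

section Left

variable {W X : ComplexTorusCat} {gW gX gXX gWX gT : ℕ} (eW : Fin (2 * gW) ≃ W.toIsog.ι) (eX : Fin (2 * gX) ≃ X.toIsog.ι)
  (eXX : Fin (2 * gXX) ≃ (prodObj X X).toIsog.ι) (eWX : Fin (2 * gWX) ≃ (prodObj W X).toIsog.ι) (eT : Fin (2 * gT) ≃ (prodObj W (prodObj X X)).toIsog.ι)
  (hgW : gW + gW = 2 * gW) (hX0 : 2 * gX + 2 * 0 = 2 * gX) (hgX : gX + gX = 2 * gX) (hcX : 2 * gX + 2 * gX = 2 * gXX) (hgXX : gXX + gXX = 2 * gXX)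
  (hgWX : gWX + gWX = 2 * gWX) (hgT : gT + gT = 2 * gT) (hgg : gW + gXX = gT) (hgg' : gW + gX = gWX)
  {p q r lW : ℕ} (hpq : p + q = r) (hlW : lW + 2 * p = 2 * gW)

variable {d L t e c₀ m K l₃ : ℕ} (hq : L + 2 * d = 2 * gXX) (hrd : r + d = c₀) (hdq : d + q = t) (hqd : q + d = t) (hpe : p + e = m)
  (hK : K + 2 * t = 2 * gXX) (hK' : K + 2 * e = 2 * gX) (h3 : l₃ + 2 * c₀ = 2 * gT) (h3' : l₃ + 2 * m = 2 * gWX)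

include hgg hgg' eW hgW hlW hdq in
/-- **`Π_c ∘ (x ⊠ y) = x ⊠ (y ⋆ c)`** for `x ∈ Hdgᵖ(W, ℤ)`, `y ∈ Hdg^q(X, ℤ)`, `c ∈ Hdgᵈ(X, ℤ)` (`p₁₃_*(p₁₂^*(x ⊠ y) · p₂₃^*Π_c)` on `W × (X × X)`): Fulton's
`β ∘ (γ × δ) = γ × β_*(δ)` with `(Π_c)_*(y) = y ⋆ c` (g33-#7 §2). [cite: Fulton1998, §16.1 Example 16.1.2 (a) (p0296 L1–L4)] [cite: Lange2023AbelianVarietiesComplex, §6.2.3 (p0308 L3–L7)] -/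
theorem integralHodgeClassesCorrComp_cross_pontryaginCorrespondence (x : integralHodgeClasses W.toIsog.Φ p) (y : integralHodgeClasses X.toIsog.Φ q)
    (c : integralHodgeClasses X.toIsog.Φ d) :
    integralHodgeClassesPushforward c₀ m (liftHom (fstHom W (prodObj X X)) (sndHom W (prodObj X X) ≫ sndHom X X)) eT eWX h3 hgT h3' hgWX
        (integralHodgeClassesCup (prodObj W (prodObj X X)).toIsog.Φ hrd
          (integralHodgeClassesPullbackHom (liftHom (fstHom W (prodObj X X)) (sndHom W (prodObj X X) ≫ fstHom X X)) r (integralHodgeClassesCross W X hpq x y))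
          (integralHodgeClassesPullbackHom (sndHom W (prodObj X X)) d
            (integralHodgeClassesPushforward d d (liftHom (fstHom X X) (fstHom X X + sndHom X X)) eXX eXX hq hgXX hq hgXX
              (integralHodgeClassesPullbackHom (sndHom X X) d c)))) =
      integralHodgeClassesCross W X hpe x (integralHodgeClassesPontryagin X eX eXX hgX hgXX hqd hK hK' y c) := by
  rw [integralHodgeClassesCorrComp_integralHodgeClassesCross_left hgg hgg' eW eX eXX eWX eT hgW hgX hgXX hgWX hgT hpq hrd hdq hpe hlW hK hK' h3 h3' x y,
    integralHodgeClassesPushforward_sndHom_pontryaginCorrespondence_cup_pullbackHom_fstHom X eX eXX hgX hgXX hq hdq hqd hK hK' c y]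

variable {cu c' lu t' : ℕ} (hc' : gX + cu = c') (hlu : lu + 2 * cu = 2 * gX) (hlu' : lu + 2 * c' = 2 * gXX) (hrc' : r + c' = c₀) (hc'q : c' + q = t)
  (hcuq : cu + q = e)

include hgg hgg' eW hgW hlW hc'q hK hK' in
/-- **`Δ_*(u) ∘ (x ⊠ y) = x ⊠ (u · y)`** for `u ∈ Hdgᶜ(X, ℤ)`: the multiplication correspondence (g33-#3; for `u = θ` the Lefschetz operator) acts on the second factor of a
degenerate correspondence (`(Δ_*(u))_*(y) = u · y`, g33-#3 §2). [cite: Fulton1998, §16.1 Example 16.1.2 (a) (p0296 L1–L4) and Example 16.1.14 (ii) (p0302 L14–L20)] -/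
theorem integralHodgeClassesCorrComp_cross_pushforward_diagHom (x : integralHodgeClasses W.toIsog.Φ p) (y : integralHodgeClasses X.toIsog.Φ q)
    (u : integralHodgeClasses X.toIsog.Φ cu) :
    integralHodgeClassesPushforward c₀ m (liftHom (fstHom W (prodObj X X)) (sndHom W (prodObj X X) ≫ sndHom X X)) eT eWX h3 hgT h3' hgWX
        (integralHodgeClassesCup (prodObj W (prodObj X X)).toIsog.Φ hrc'
          (integralHodgeClassesPullbackHom (liftHom (fstHom W (prodObj X X)) (sndHom W (prodObj X X) ≫ fstHom X X)) r (integralHodgeClassesCross W X hpq x y))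
          (integralHodgeClassesPullbackHom (sndHom W (prodObj X X)) c' (integralHodgeClassesPushforward cu c' (diagHom X) eX eXX hlu hgX hlu' hgXX u))) =
      integralHodgeClassesCross W X hpe x (integralHodgeClassesCup X.toIsog.Φ hcuq u y) := by
  rw [integralHodgeClassesCorrComp_integralHodgeClassesCross_left hgg hgg' eW eX eXX eWX eT hgW hgX hgXX hgWX hgT hpq hrc' hc'q hpe hlW hK hK' h3 h3' x y,
    integralHodgeClassesPushforward_sndHom_pushforward_diagHom_cup_pullbackHom_fstHom X eX eXX hgX hgXX hlu hlu' hc'q hcuq hK hK' u y]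

variable {rg tg : ℕ} (hrg : r + gX = rg) (htg : gX + q = tg) (hKg : K + 2 * tg = 2 * gXX) (hKq : K + 2 * q = 2 * gX) (hpq' : p + q = m)
  (h3g : l₃ + 2 * rg = 2 * gT)

include hgg hgg' eW hgW hlW htg hKg hKq in
/-- **`H ∘ (x ⊠ y) = (2q − g) • (x ⊠ y)`** for `y ∈ Hdg^q(X, ℤ)`, `g = dim X`: the degenerate correspondence `x ⊠ y` is an eigen-correspondence of the grading `H = Σ_s (s −
g) π_s` (g33-#5) for LEFT composition, with the weight of its target factor (`H_*(y) = (2q − g) • y`, g33-#6 §1).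
[cite: Huybrechts2005, §1.2 Def. 1.2.25 (p0047 L7–L9)] [cite: Fulton1998, §16.1 Example 16.1.2 (a) (p0296 L1–L4)] -/
theorem integralHodgeClassesCorrComp_cross_kunnethGrading (x : integralHodgeClasses W.toIsog.Φ p) (y : integralHodgeClasses X.toIsog.Φ q) :
    integralHodgeClassesPushforward rg m (liftHom (fstHom W (prodObj X X)) (sndHom W (prodObj X X) ≫ sndHom X X)) eT eWX h3g hgT h3' hgWX
        (integralHodgeClassesCup (prodObj W (prodObj X X)).toIsog.Φ hrg
          (integralHodgeClassesPullbackHom (liftHom (fstHom W (prodObj X X)) (sndHom W (prodObj X X) ≫ fstHom X X)) r (integralHodgeClassesCross W X hpq x y))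
          (integralHodgeClassesPullbackHom (sndHom W (prodObj X X)) gX (kunnethGrading X eX eXX hX0 hgX hcX hgXX))) =
      ((2 * q : ℤ) - gX) • integralHodgeClassesCross W X hpq' x y := by
  rw [integralHodgeClassesCorrComp_integralHodgeClassesCross_left hgg hgg' eW eX eXX eWX eT hgW hgX hgXX hgWX hgT hpq hrg htg hpq' hlW hKg hKq h3g h3' x y,
    integralHodgeClassesPushforward_sndHom_kunnethGrading_cup_pullbackHom_fstHom X eX eXX hX0 hgX hcX hgXX htg hKg hKq y, integralHodgeClassesCross_zsmul_right]

end Left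

/-! ## §4 Degenerate correspondences `x ⊠ y` as eigen-correspondences: compositions on the right -/

section Right

variable {X Z : ComplexTorusCat} {gX gZ gXX gXZ gT : ℕ} (eX : Fin (2 * gX) ≃ X.toIsog.ι) (eZ : Fin (2 * gZ) ≃ Z.toIsog.ι)
  (eXX : Fin (2 * gXX) ≃ (prodObj X X).toIsog.ι) (eXZ : Fin (2 * gXZ) ≃ (prodObj X Z).toIsog.ι) (eT : Fin (2 * gT) ≃ (prodObj X (prodObj X Z)).toIsog.ι)
  (hX0 : 2 * gX + 2 * 0 = 2 * gX) (hgX : gX + gX = 2 * gX) (hcX : 2 * gX + 2 * gX = 2 * gXX) (hgXX : gXX + gXX = 2 * gXX) (hgZ : gZ + gZ = 2 * gZ)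
  (hgXZ : gXZ + gXZ = 2 * gXZ) (hgT : gT + gT = 2 * gT) (hggT : gXX + gZ = gT) (hgg₃ : gX + gZ = gXZ)
  {p q r lr lZ : ℕ} (hpq : p + q = r) (hlr : lr + 2 * r = 2 * gXZ) (hlZ : lZ + 2 * q = 2 * gZ)

variable {d L t e c₀ m K l₃ : ℕ} (hq : L + 2 * d = 2 * gXX) (hdr : d + r = c₀) (hdp : d + p = t) (hpd : p + d = t) (heq : e + q = m)
  (hK : K + 2 * t = 2 * gXX) (hK' : K + 2 * e = 2 * gX) (h3 : l₃ + 2 * c₀ = 2 * gT) (h3' : l₃ + 2 * m = 2 * gXZ)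

include hggT hgg₃ eZ hgZ hlr hlZ hdp in
/-- **`(x ⊠ y) ∘ Π_c = (x ⋆ c) ⊠ y`** for `x ∈ Hdgᵖ(X, ℤ)`, `y ∈ Hdg^q(Z, ℤ)`, `c ∈ Hdgᵈ(X, ℤ)` (`p₁₃_*(p₁₂^*Π_c · p₂₃^*(x ⊠ y))` on `X × (X × Z)`): Fulton's `(γ × δ) ∘ α
= α^*(γ) × δ` with `(Π_c)^*(x) = x ⋆ c` (g34-#1 §2, the symmetry `ᵗΠ_c = Π_c`). [cite: Fulton1998, §16.1 Example 16.1.2 (b) (p0296 L5–L8)] [cite: Lange2023AbelianVarietiesComplex, §6.2.3 (p0308 L3–L7)] -/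
theorem integralHodgeClassesCorrComp_pontryaginCorrespondence_cross (x : integralHodgeClasses X.toIsog.Φ p) (y : integralHodgeClasses Z.toIsog.Φ q)
    (c : integralHodgeClasses X.toIsog.Φ d) :
    integralHodgeClassesPushforward c₀ m (liftHom (fstHom X (prodObj X Z)) (sndHom X (prodObj X Z) ≫ sndHom X Z)) eT eXZ h3 hgT h3' hgXZ
        (integralHodgeClassesCup (prodObj X (prodObj X Z)).toIsog.Φ hdr
          (integralHodgeClassesPullbackHom (liftHom (fstHom X (prodObj X Z)) (sndHom X (prodObj X Z) ≫ fstHom X Z)) d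
            (integralHodgeClassesPushforward d d (liftHom (fstHom X X) (fstHom X X + sndHom X X)) eXX eXX hq hgXX hq hgXX
              (integralHodgeClassesPullbackHom (sndHom X X) d c)))
          (integralHodgeClassesPullbackHom (sndHom X (prodObj X Z)) r (integralHodgeClassesCross X Z hpq x y))) =
      integralHodgeClassesCross X Z heq (integralHodgeClassesPontryagin X eX eXX hgX hgXX hpd hK hK' x c) y := by
  rw [integralHodgeClassesCorrComp_integralHodgeClassesCross_right hggT hgg₃ eX eZ eXX eXZ eXZ eT hgX hgZ hgXX hgXZ hgXZ hgT hpq hdr hdp heq hq hlr hlZ hK hK' h3 h3'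
      _ x y,
    integralHodgeClassesPushforward_fstHom_pontryaginCorrespondence_cup_pullbackHom_sndHom X eX eXX hgX hgXX hq hdp hpd hK hK' c x]

variable {cu c' lu : ℕ} (hc' : gX + cu = c') (hlu : lu + 2 * cu = 2 * gX) (hlu' : lu + 2 * c' = 2 * gXX) (hc'r : c' + r = c₀) (hc'p : c' + p = t)
  (hcup : cu + p = e)

include hggT hgg₃ eZ hgZ hlr hlZ hc'p hK hK' in
/-- **`(x ⊠ y) ∘ Δ_*(u) = (u · x) ⊠ y`** for `u ∈ Hdgᶜ(X, ℤ)` (`(Δ_*(u))^*(x) = u · x`, g33-#3 §2). [cite: Fulton1998, §16.1 Example 16.1.2 (b) (p0296 L5–L8) and Example 16.1.14 (ii) (p0302 L14–L20)] -/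
theorem integralHodgeClassesCorrComp_pushforward_diagHom_cross (x : integralHodgeClasses X.toIsog.Φ p) (y : integralHodgeClasses Z.toIsog.Φ q)
    (u : integralHodgeClasses X.toIsog.Φ cu) :
    integralHodgeClassesPushforward c₀ m (liftHom (fstHom X (prodObj X Z)) (sndHom X (prodObj X Z) ≫ sndHom X Z)) eT eXZ h3 hgT h3' hgXZ
        (integralHodgeClassesCup (prodObj X (prodObj X Z)).toIsog.Φ hc'r
          (integralHodgeClassesPullbackHom (liftHom (fstHom X (prodObj X Z)) (sndHom X (prodObj X Z) ≫ fstHom X Z)) c'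
            (integralHodgeClassesPushforward cu c' (diagHom X) eX eXX hlu hgX hlu' hgXX u))
          (integralHodgeClassesPullbackHom (sndHom X (prodObj X Z)) r (integralHodgeClassesCross X Z hpq x y))) =
      integralHodgeClassesCross X Z heq (integralHodgeClassesCup X.toIsog.Φ hcup u x) y := by
  rw [integralHodgeClassesCorrComp_integralHodgeClassesCross_right hggT hgg₃ eX eZ eXX eXZ eXZ eT hgX hgZ hgXX hgXZ hgXZ hgT hpq hc'r hc'p heq hlu' hlr hlZ hK hK' h3
      h3' _ x y,
    integralHodgeClassesPushforward_fstHom_pushforward_diagHom_cup_pullbackHom_sndHom X eX eXX hgX hgXX hlu hlu' hc'p hcup hK hK' u x]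

variable {gr tg : ℕ} (hgr : gX + r = gr) (htg : gX + p = tg) (hKg : K + 2 * tg = 2 * gXX) (hKp : K + 2 * p = 2 * gX) (hpq' : p + q = m)
  (h3g : l₃ + 2 * gr = 2 * gT)

include hggT hgg₃ eZ hgZ hlr hlZ htg hKg hKp in
/-- **`(x ⊠ y) ∘ H = (g − 2p) • (x ⊠ y)`** for `x ∈ Hdgᵖ(X, ℤ)`, `g = dim X`: for RIGHT composition the weight is that of the source factor, read contravariantly
(`H^*(x) = (g − 2p) • x`, g33-#6 §1; `H′ = −H`). With §3: `H_X ∘ (x ⊠ y) − (x ⊠ y) ∘ H_W = (2p + 2q − g_W − g_X) • (x ⊠ y)`, the weight identity of g33-#5 on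
rank-one correspondences. [cite: Huybrechts2005, §1.2 Def. 1.2.25 (p0047 L7–L9)] [cite: Fulton1998, §16.1 Example 16.1.2 (b) (p0296 L5–L8)] -/
theorem integralHodgeClassesCorrComp_kunnethGrading_cross (x : integralHodgeClasses X.toIsog.Φ p) (y : integralHodgeClasses Z.toIsog.Φ q) :
    integralHodgeClassesPushforward gr m (liftHom (fstHom X (prodObj X Z)) (sndHom X (prodObj X Z) ≫ sndHom X Z)) eT eXZ h3g hgT h3' hgXZ
        (integralHodgeClassesCup (prodObj X (prodObj X Z)).toIsog.Φ hgr
          (integralHodgeClassesPullbackHom (liftHom (fstHom X (prodObj X Z)) (sndHom X (prodObj X Z) ≫ fstHom X Z)) gX (kunnethGrading X eX eXX hX0 hgX hcX hgXX))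
          (integralHodgeClassesPullbackHom (sndHom X (prodObj X Z)) r (integralHodgeClassesCross X Z hpq x y))) =
      ((gX : ℤ) - 2 * p) • integralHodgeClassesCross X Z hpq' x y := by
  rw [integralHodgeClassesCorrComp_integralHodgeClassesCross_right hggT hgg₃ eX eZ eXX eXZ eXZ eT hgX hgZ hgXX hgXZ hgXZ hgT hpq hgr htg hpq' hcX hlr hlZ hKg hKp h3g
      h3' _ x y,
    integralHodgeClassesPushforward_fstHom_kunnethGrading_cup_pullbackHom_sndHom X eX eXX hX0 hgX hcX hgXX htg hKg hKp x, integralHodgeClassesCross_zsmul_left]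

end Right

/-! ## §5 Rank-one correspondences compose like matrix units: `(x′ ⊠ y′) ∘ (x ⊠ y) = deg_X(x′ · y) • (x ⊠ y′)` -/

section MatrixUnits

variable {W X Z : ComplexTorusCat} {gW gX gZ gXZ gWX gWZ gT : ℕ} (eW : Fin (2 * gW) ≃ W.toIsog.ι) (eX : Fin (2 * gX) ≃ X.toIsog.ι) (eZ : Fin (2 * gZ) ≃ Z.toIsog.ι)
  (eXZ : Fin (2 * gXZ) ≃ (prodObj X Z).toIsog.ι) (eWX : Fin (2 * gWX) ≃ (prodObj W X).toIsog.ι) (eWZ : Fin (2 * gWZ) ≃ (prodObj W Z).toIsog.ι)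
  (eT : Fin (2 * gT) ≃ (prodObj W (prodObj X Z)).toIsog.ι)
  (hgW : gW + gW = 2 * gW) (hgX : gX + gX = 2 * gX) (hgZ : gZ + gZ = 2 * gZ) (hgXZ : gXZ + gXZ = 2 * gXZ) (hgWZ : gWZ + gWZ = 2 * gWZ) (hgT : gT + gT = 2 * gT)
  (hgg : gW + gXZ = gT) (hgg' : gW + gZ = gWZ) (hggZ : gX + gZ = gXZ)
  {p q p' q' r b c₀ t m lW l L l₃ : ℕ} (hpq : p + q = r) (hp'q' : p' + q' = b) (hrb : r + b = c₀) (hp'q : p' + q = gX) (hbq : b + q = t) (ht : gX + q' = t)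
  (hpq'm : p + q' = m) (hlW : lW + 2 * p = 2 * gW) (hl : l + 2 * gX = 2 * gXZ) (hl0 : l + 2 * 0 = 2 * gZ) (hL : L + 2 * t = 2 * gXZ) (hL' : L + 2 * q' = 2 * gZ)
  (h3 : l₃ + 2 * c₀ = 2 * gT) (h3' : l₃ + 2 * m = 2 * gWZ)

include hgg hgg' hggZ eW eZ eXZ hgW hgZ hgXZ hlW hbq ht hl hl0 hL hL' in
/-- **`(x′ ⊠ y′) ∘ (x ⊠ y) = deg_X(x′ · y) • (x ⊠ y′)`** for `x ∈ Hdgᵖ(W, ℤ)`, `y ∈ Hdg^q(X, ℤ)`, `x′ ∈ Hdg^{g−q}(X, ℤ)`, `y′ ∈ Hdg^{q′}(Z, ℤ)` (composite on `W × (X × Z)`):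
RANK-ONE CORRESPONDENCES COMPOSE LIKE MATRIX UNITS, through the intersection number of the inner classes — Fulton's "if `α = [V × W]`, then `β ∘ α = [V] × p_{Z*}([W ×
Z] · β)`" (g29 `…CorrComp_integralHodgeClassesCross_left`) with the degenerate action `(x′ ⊠ y′)_*(y) = deg_X(x′ · y) · y′` (g27-#6). The two-sided ideal `I(X, X)` of
degenerate correspondences. [cite: Fulton1998, §16.1 Example 16.1.2 (a) (p0296 L7–L9)] [cite: Lange2023AbelianVarietiesComplex, §6.2.4 (6.10) (p0310 L33–L35)] -/
theorem integralHodgeClassesCorrComp_cross_cross (x : integralHodgeClasses W.toIsog.Φ p) (y : integralHodgeClasses X.toIsog.Φ q) (x' : integralHodgeClasses X.toIsog.Φ p')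
    (y' : integralHodgeClasses Z.toIsog.Φ q') :
    integralHodgeClassesPushforward c₀ m (liftHom (fstHom W (prodObj X Z)) (sndHom W (prodObj X Z) ≫ sndHom X Z)) eT eWZ h3 hgT h3' hgWZ
        (integralHodgeClassesCup (prodObj W (prodObj X Z)).toIsog.Φ hrb
          (integralHodgeClassesPullbackHom (liftHom (fstHom W (prodObj X Z)) (sndHom W (prodObj X Z) ≫ fstHom X Z)) r (integralHodgeClassesCross W X hpq x y))
          (integralHodgeClassesPullbackHom (sndHom W (prodObj X Z)) b (integralHodgeClassesCross X Z hp'q' x' y'))) =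
      integralHodgeClassesDeg X eX (integralHodgeClassesCup X.toIsog.Φ hp'q x' y) • integralHodgeClassesCross W Z hpq'm x y' := by
  rw [integralHodgeClassesCorrComp_integralHodgeClassesCross_left hgg hgg' eW eZ eXZ eWZ eT hgW hgZ hgXZ hgWZ hgT hpq hrb hbq hpq'm hlW hL hL' h3 h3' x y,
    integralHodgeClassesPushforward_sndHom_cross_cup_pullbackHom_fstHom X Z hggZ eX eZ eXZ hgZ hgXZ hp'q hp'q' ht hbq hl hl0 hL hL' x' y y',
    integralHodgeClassesCross_zsmul_right]

end MatrixUnits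

/-! ## §6 `⋆ c` is self-adjoint for the intersection pairing: `deg((x ⋆ c) · y) = deg(x · (y ⋆ c))` -/

section SelfAdjoint

variable (X : ComplexTorusCat) {gX gXX : ℕ} (eX : Fin (2 * gX) ≃ X.toIsog.ι) (eXX : Fin (2 * gXX) ≃ (prodObj X X).toIsog.ι) (hgX : gX + gX = 2 * gX)
  (hgXX : gXX + gXX = 2 * gXX) {d L p q s s' t t' ls lt : ℕ} (hq : L + 2 * d = 2 * gXX) (hs : d + p = s) (hps : p + d = s) (ht₂ : s' + q = gX)
  (hu : d + q = t) (hqd : q + d = t) (hu' : p + t' = gX) (hls : ls + 2 * s = 2 * gXX) (hls' : ls + 2 * s' = 2 * gX) (hlt : lt + 2 * t = 2 * gXX)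
  (hlt' : lt + 2 * t' = 2 * gX)

include eXX hgXX hq hs hu in
/-- **`deg_X((x ⋆ c) · y) = deg_X(x · (y ⋆ c))`** for `x ∈ Hdgᵖ`, `y ∈ Hdg^q`, `c ∈ Hdgᵈ` with `p + q + d = 2g`: THE PONTRYAGIN PRODUCT WITH `c` IS SELF-ADJOINT FOR THE
INTERSECTION PAIRING — Fulton's adjunction "`∫_X a · α^*(b) = ∫_Y α_*(a) · b`" (Example 16.1.14 (i), g28 `integralHodgeClassesDeg_corrAct_cup_eq_deg_cup_corrCoact`) for `α =
Π_c`, whose two actions coincide: `(Π_c)_* = (Π_c)^* = (−) ⋆ c` (g33-#7 §2, g34-#1 §§1–2). [cite: Fulton1998, §16.1 Example 16.1.14 (i) (p0302 L7–L12)]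
[cite: Lange2023AbelianVarietiesComplex, §6.2.3 (p0308 L3–L7)] -/
theorem integralHodgeClassesDeg_pontryagin_cup_eq_deg_cup_pontryagin (c : integralHodgeClasses X.toIsog.Φ d) (x : integralHodgeClasses X.toIsog.Φ p)
    (y : integralHodgeClasses X.toIsog.Φ q) :
    integralHodgeClassesDeg X eX (integralHodgeClassesCup X.toIsog.Φ ht₂ (integralHodgeClassesPontryagin X eX eXX hgX hgXX hps hls hls' x c) y) =
      integralHodgeClassesDeg X eX (integralHodgeClassesCup X.toIsog.Φ hu' x (integralHodgeClassesPontryagin X eX eXX hgX hgXX hqd hlt hlt' y c)) := by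
  have h := integralHodgeClassesDeg_corrAct_cup_eq_deg_cup_corrCoact (eX := eX) (eY := eX) (eXY := eXX) (hgX := hgX) (hgY := hgX) (hgXY := hgXX) (hs := hs)
    (ht₂ := ht₂) (hu := hu) (hu' := hu') (hls := hls) (hls' := hls') (hlt := hlt) (hlt' := hlt')
    (integralHodgeClassesPushforward d d (liftHom (fstHom X X) (fstHom X X + sndHom X X)) eXX eXX hq hgXX hq hgXX (integralHodgeClassesPullbackHom (sndHom X X) d c)) x y
  rwa [integralHodgeClassesPushforward_sndHom_pontryaginCorrespondence_cup_pullbackHom_fstHom X eX eXX hgX hgXX hq hs hps hls hls' c x,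
    integralHodgeClassesPushforward_fstHom_pontryaginCorrespondence_cup_pullbackHom_sndHom X eX eXX hgX hgXX hq hu hqd hlt hlt' c y] at h

end SelfAdjoint

end ComplexTorusCat

end Literature.AlgebraicGeometry.HodgeTheory
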